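import Literature.Computability.MetaComplexity.XorPseudoexpectation
import HarnessLib

/-!
# Lifting Boolean juntas into the parity group algebra (orthogonal idempotents of a window)

Support for SOS degree lower bounds obtained by LOW-DEGREE REDUCTION from XOR systems (Grigoriev
2001, Lemmas 9–10: Tseitin `→` parity/`MOD2`; Buss–Grigoriev–Impagliazzo–Pitassi 2001, §7), in the
language of `XorPseudoexpectation.lean` (`ParityAlg = ℝ[ParityVec]`, `phiX e = (1 - y_e)/2` the
image of the `0/1` variable `x_e`, `SuppIn`, `momentFunctional`).

Fix a finite WINDOW `D ⊆ ℕ` of `0/1` variables. For `A ⊆ D` (the pattern "`x_e = 1` iff `e ∈ A`")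
the **pattern idempotent** is `ι_{D,A} = ∏_{e ∈ D} (x_e if e ∈ A, else 1 - x_e)` read in `ParityAlg`
(`patternIdem D A`). These are pairwise orthogonal idempotents summing to `1`
(`patternIdem_mul_self`, `patternIdem_mul_eq_zero`, `sum_patternIdem`), so
`B ↦ Σ_{A ⊆ D} B(A) · ι_{D,A}` is an `ℝ`-ALGEBRA HOMOMORPHISM from set functions
`B : Finset ℕ → ℝ` (pointwise ring structure; only the values on subsets of `D` matter) to
`ParityAlg` — `cubeLift D` ("multilinear interpolation modulo Booleanity, then `x ↦ (1-y)/2`").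
Consequences used downstream:

* `cubeLift_congr` (only values on `A ⊆ D` matter), `cubeLift_eq_of_subset` (a `D`-junta may be
  lifted in any larger window), `cubeLift_indicator_mem` (`[e ∈ A] ↦ x_e = phiX e`);
* `suppIn_cubeLift` (every monomial `y_T` of a lift has `T ⊆ D`, hence `|T| ≤ |D|`:
  `SuppIn.card_support_le`);
* `cubeLift_even` — the parity junta lifts to `(1 + y_D)/2`, `y_D = ∏_{e ∈ D} y_e`
  (`yMon (indVec D)`), which is what a Grigoriev–Schoenebeck moment functional with right-hand
  side `y_D = -1` annihilates.

With this, checking that a substitution `X ↦ cubeLift D_X (semantics of X)` satisfies a polynomial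
identity EXACTLY in `ParityAlg` reduces to checking the identity pointwise on `0/1` patterns.

## References

* D. Grigoriev, *Linear lower bound on degrees of Positivstellensatz calculus proofs for the
  parity*, Theoret. Comput. Sci. 259 (2001) 613–622, Def. 8, Lemmas 9–10. [Grigoriev2001TCS]
* S. Buss, D. Grigoriev, R. Impagliazzo, T. Pitassi, *Linear gaps between degrees for the
  polynomial calculus modulo distinct primes*, JCSS 62 (2001), §7 (low-degree reductions).
-/

noncomputable section

open Finset
open scoped symmDiff

namespace Literature.Computability.MetaComplexity

/-! ### The two idempotents of one variable -/

/-- `(1 - x_e)² = 1 - x_e` in `ParityAlg` (`x_e = (1 - y_e)/2`, `y_e² = 1`). [cite: Grigoriev2001TCS, Lemma 10 (proof)] -/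
theorem one_sub_phiX_mul_self (e : ℕ) : (1 - phiX e) * (1 - phiX e) = 1 - phiX e := by
  linear_combination phiX_mul_self e

/-- `x_e (1 - x_e) = 0` in `ParityAlg`. [cite: Grigoriev2001TCS, Lemma 10 (proof)] -/
theorem phiX_mul_one_sub (e : ℕ) : phiX e * (1 - phiX e) = 0 := by
  linear_combination (-1 : ParityAlg) * phiX_mul_self e

/-- `y_e · x_e = -x_e` (`y_e = 1 - 2 x_e`, `x_e² = x_e`). [cite: Grigoriev2001TCS, Lemma 10 (proof)] -/
theorem yMon_single_mul_phiX (e : ℕ) : yMon (Finsupp.single e 1) * phiX e = -phiX e := by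
  unfold phiX
  set Y := yMon (Finsupp.single e 1) with hYdef
  have hY : Y * Y = 1 := yMon_mul_self _
  rw [Algebra.smul_def]
  set C := algebraMap ℝ ParityAlg (1 / 2 : ℝ) with hC
  linear_combination (-C) * hY

/-- `y_e · (1 - x_e) = 1 - x_e`. [cite: Grigoriev2001TCS, Lemma 10 (proof)] -/
theorem yMon_single_mul_one_sub_phiX (e : ℕ) :
    yMon (Finsupp.single e 1) * (1 - phiX e) = 1 - phiX e := by
  have h1 := yMon_single_mul_phiX e
  unfold phiX at h1 ⊢
  set Y := yMon (Finsupp.single e 1) with hYdef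
  have hY : Y * Y = 1 := yMon_mul_self _
  rw [Algebra.smul_def] at h1 ⊢
  set C := algebraMap ℝ ParityAlg (1 / 2 : ℝ) with hC
  have h2C : 2 * C = 1 := by
    rw [hC, show (2 : ParityAlg) = algebraMap ℝ ParityAlg 2 from (map_ofNat _ 2).symm, ← map_mul,
      show (2 : ℝ) * (1 / 2) = 1 by norm_num, map_one]
  linear_combination (1 - Y) * h2C + C * hY

/-! ### Pattern idempotents of a window -/

/-- The **pattern idempotent** `ι_{D,A} = ∏_{e ∈ D} (x_e if e ∈ A else 1 - x_e)` of the window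
`D` at the pattern `A` ("`x_e = 1` iff `e ∈ A`", only `A ∩ D` matters), read in `ParityAlg`.
[cite: Grigoriev2001TCS, Def. 8 and Lemma 10 (substitutions of Boolean polynomials)] -/
def patternIdem (D A : Finset ℕ) : ParityAlg :=
  ∏ e ∈ D, if e ∈ A then phiX e else 1 - phiX e

/-- Only the trace `A ∩ D` of the pattern matters. [cite: Grigoriev2001TCS, Lemma 10 (proof)] -/
theorem patternIdem_congr {D A A' : Finset ℕ} (h : ∀ e ∈ D, (e ∈ A ↔ e ∈ A')) :
    patternIdem D A = patternIdem D A' :=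
  prod_congr rfl fun e he => by
    by_cases hA : e ∈ A
    · rw [if_pos hA, if_pos ((h e he).1 hA)]
    · rw [if_neg hA, if_neg fun h' => hA ((h e he).2 h')]

/-- `ι_{D,A}` is idempotent. [cite: Grigoriev2001TCS, Lemma 10 (proof)] -/
theorem patternIdem_mul_self (D A : Finset ℕ) :
    patternIdem D A * patternIdem D A = patternIdem D A := by
  unfold patternIdem
  rw [← prod_mul_distrib]
  refine prod_congr rfl fun e _ => ?_
  split_ifs
  · exact phiX_mul_self e
  · exact one_sub_phiX_mul_self e

/-- Distinct patterns (on the window) give orthogonal idempotents: if some `e ∈ D` lies in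
exactly one of `A`, `A'` then `ι_{D,A} ι_{D,A'} = 0`. [cite: Grigoriev2001TCS, Lemma 10 (proof)] -/
theorem patternIdem_mul_eq_zero {D A A' : Finset ℕ} {e : ℕ} (he : e ∈ D)
    (h : ¬ (e ∈ A ↔ e ∈ A')) : patternIdem D A * patternIdem D A' = 0 := by
  unfold patternIdem
  rw [← prod_mul_distrib]
  apply prod_eq_zero he
  by_cases hA : e ∈ A
  · have hA' : e ∉ A' := fun h' => h ⟨fun _ => h', fun _ => hA⟩
    rw [if_pos hA, if_neg hA', phiX_mul_one_sub]
  · have hA' : e ∈ A' := by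
      by_contra h'
      exact h ⟨fun h'' => absurd h'' hA, fun h'' => absurd h'' h'⟩
    rw [if_neg hA, if_pos hA', mul_comm, phiX_mul_one_sub]

/-- Subsets of the window that differ are separated by an element of the window. [cite: Grigoriev2001TCS, Lemma 10 (proof)] -/
theorem exists_mem_not_iff_of_ne {D A A' : Finset ℕ} (hA : A ⊆ D) (hA' : A' ⊆ D) (hne : A ≠ A') :
    ∃ e ∈ D, ¬ (e ∈ A ↔ e ∈ A') := by
  by_contra hcon
  push Not at hcon
  apply hne
  ext e
  by_cases he : e ∈ D
  · exact hcon e he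
  · exact ⟨fun h => absurd (hA h) he, fun h => absurd (hA' h) he⟩

/-- Split form: for `A ⊆ D`, `ι_{D,A} = (∏_{e ∈ A} x_e) · ∏_{e ∈ D \ A} (1 - x_e)`. [cite: Grigoriev2001TCS, Lemma 10 (proof)] -/
theorem patternIdem_eq_prod_mul_prod {D A : Finset ℕ} (hA : A ⊆ D) :
    patternIdem D A = (∏ e ∈ A, phiX e) * ∏ e ∈ D \ A, (1 - phiX e) := by
  unfold patternIdem
  rw [prod_ite, filter_mem_eq_inter, inter_eq_right.2 hA]
  congr 1
  refine prod_congr ?_ fun _ _ => rfl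
  ext e
  simp only [mem_filter, mem_sdiff]

/-- **Partition of unity**: `Σ_{A ⊆ D} ι_{D,A} = ∏_{e ∈ D} (x_e + (1 - x_e)) = 1`. [cite: Grigoriev2001TCS, Lemma 10 (proof)] -/
theorem sum_patternIdem (D : Finset ℕ) : ∑ A ∈ D.powerset, patternIdem D A = 1 := by
  calc ∑ A ∈ D.powerset, patternIdem D A
      = ∑ A ∈ D.powerset, (∏ e ∈ A, phiX e) * ∏ e ∈ D \ A, (1 - phiX e) :=
        sum_congr rfl fun A hA => patternIdem_eq_prod_mul_prod (mem_powerset.1 hA)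
    _ = ∏ e ∈ D, (phiX e + (1 - phiX e)) := (prod_add _ _ _).symm
    _ = 1 := by simp

/-- Adding a fresh variable to the window splits off one factor. [cite: Grigoriev2001TCS, Lemma 10 (proof)] -/
theorem patternIdem_insert {D A : Finset ℕ} {e : ℕ} (he : e ∉ D) :
    patternIdem (insert e D) A = (if e ∈ A then phiX e else 1 - phiX e) * patternIdem D A := by
  unfold patternIdem
  rw [prod_insert he]

/-- Every monomial `y_T` of `ι_{D,A}` has `T ⊆ D`. [cite: Grigoriev2001TCS, Lemma 10 (proof)] -/
theorem suppIn_patternIdem (D A : Finset ℕ) : SuppIn D (patternIdem D A) := by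
  classical
  unfold patternIdem
  have h := SuppIn.prod (s := D) (B := fun e : ℕ => ({e} : Finset ℕ))
    (f := fun e => if e ∈ A then phiX e else 1 - phiX e) (fun e _ => by
      by_cases hA : e ∈ A
      · rw [if_pos hA]; exact suppIn_phiX e
      · rw [if_neg hA]; exact (suppIn_one _).sub (suppIn_phiX e))
  rwa [biUnion_singleton_eq_self] at h

/-! ### The lift of a set function -/

/-- The underlying function of `cubeLift`: `B ↦ Σ_{A ⊆ D} B(A) · ι_{D,A}`.
[cite: Grigoriev2001TCS, Def. 8 (substitution polynomials `s_i`)] -/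
def cubeLiftFun (D : Finset ℕ) (B : Finset ℕ → ℝ) : ParityAlg :=
  ∑ A ∈ D.powerset, B A • patternIdem D A

/-- Multiplicativity of the lift (orthogonality of the pattern idempotents). [cite: Grigoriev2001TCS, Lemma 10 (proof)] -/
theorem cubeLiftFun_mul (D : Finset ℕ) (B B' : Finset ℕ → ℝ) :
    cubeLiftFun D (B * B') = cubeLiftFun D B * cubeLiftFun D B' := by
  unfold cubeLiftFun
  rw [sum_mul_sum]
  refine sum_congr rfl fun A hA => ?_
  have hAD : A ⊆ D := mem_powerset.1 hA
  rw [Finset.sum_eq_single_of_mem A hA]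
  · rw [smul_mul_assoc, mul_smul_comm, smul_smul, patternIdem_mul_self, Pi.mul_apply]
  · intro A' hA' hne
    obtain ⟨e, he, h⟩ := exists_mem_not_iff_of_ne hAD (mem_powerset.1 hA') (Ne.symm hne)
    rw [smul_mul_assoc, mul_smul_comm, patternIdem_mul_eq_zero he h, smul_zero, smul_zero]

/-- **The lift** `B ↦ Σ_{A ⊆ D} B(A) · ι_{D,A}` as an `ℝ`-algebra homomorphism from set functions
(pointwise operations) to `ParityAlg`: the image of the Boolean junta `x ↦ B({e ∈ D : x_e = 1})`
under "multilinearise, then `x_e ↦ (1 - y_e)/2`". [cite: Grigoriev2001TCS, Def. 8 and Lemma 10] -/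
def cubeLift (D : Finset ℕ) : (Finset ℕ → ℝ) →ₐ[ℝ] ParityAlg where
  toFun := cubeLiftFun D
  map_one' := by
    unfold cubeLiftFun
    simp only [Pi.one_apply, one_smul, sum_patternIdem]
  map_mul' := cubeLiftFun_mul D
  map_zero' := by
    unfold cubeLiftFun
    simp only [Pi.zero_apply, zero_smul, sum_const_zero]
  map_add' B B' := by
    unfold cubeLiftFun
    simp only [Pi.add_apply, add_smul, sum_add_distrib]
  commutes' r := by
    unfold cubeLiftFun
    simp only [Pi.algebraMap_apply, Algebra.algebraMap_self_apply]
    rw [← smul_sum, sum_patternIdem, Algebra.algebraMap_eq_smul_one]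

/-- Unfolding the lift. [cite: Grigoriev2001TCS, Lemma 10 (proof)] -/
theorem cubeLift_apply (D : Finset ℕ) (B : Finset ℕ → ℝ) :
    cubeLift D B = ∑ A ∈ D.powerset, B A • patternIdem D A := rfl

/-- Only the values of `B` on subsets of the window matter. [cite: Grigoriev2001TCS, Lemma 10 (proof)] -/
theorem cubeLift_congr {D : Finset ℕ} {B B' : Finset ℕ → ℝ} (h : ∀ A, A ⊆ D → B A = B' A) :
    cubeLift D B = cubeLift D B' := by
  rw [cubeLift_apply, cubeLift_apply]
  exact sum_congr rfl fun A hA => by rw [h A (mem_powerset.1 hA)]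

/-- A function vanishing on the subsets of the window lifts to `0`. [cite: Grigoriev2001TCS, Lemma 10 (proof)] -/
theorem cubeLift_eq_zero {D : Finset ℕ} {B : Finset ℕ → ℝ} (h : ∀ A, A ⊆ D → B A = 0) :
    cubeLift D B = 0 := by
  rw [cubeLift_congr (B' := 0) fun A hA => by rw [h A hA, Pi.zero_apply], map_zero]

/-- Lifting a `D`-junta in the window `D` with one fresh variable added changes nothing.
[cite: Grigoriev2001TCS, Lemma 10 (proof)] -/
theorem cubeLift_insert {D : Finset ℕ} {e : ℕ} (he : e ∉ D) {B : Finset ℕ → ℝ}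
    (hB : ∀ A, B A = B (A ∩ D)) : cubeLift (insert e D) B = cubeLift D B := by
  rw [cubeLift_apply, cubeLift_apply, sum_powerset_insert he, ← sum_add_distrib]
  refine sum_congr rfl fun A hA => ?_
  have hAD : A ⊆ D := mem_powerset.1 hA
  have heA : e ∉ A := fun h => he (hAD h)
  have h1 : patternIdem D (insert e A) = patternIdem D A :=
    patternIdem_congr fun x hx => by
      rw [mem_insert]
      exact ⟨fun h => h.resolve_left (by rintro rfl; exact he hx), Or.inr⟩
  have h2 : B (insert e A) = B A := by
    rw [hB (insert e A), hB A, insert_inter_of_notMem he]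
  rw [patternIdem_insert he, patternIdem_insert he, if_neg heA, if_pos (mem_insert_self e A), h1,
    h2, ← smul_add, ← add_mul, sub_add_cancel, one_mul]

/-- **Window enlargement.** A `D`-junta (`B A = B (A ∩ D)`) has the same lift in every window
containing `D`. [cite: Grigoriev2001TCS, Lemma 10 (proof)] -/
theorem cubeLift_eq_of_subset {D D' : Finset ℕ} (hDD' : D ⊆ D') {B : Finset ℕ → ℝ}
    (hB : ∀ A, B A = B (A ∩ D)) : cubeLift D' B = cubeLift D B := by
  suffices h : ∀ S : Finset ℕ, (∀ e ∈ S, e ∉ D) → cubeLift (S ∪ D) B = cubeLift D B by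
    have := h (D' \ D) fun e he => (mem_sdiff.1 he).2
    rwa [sdiff_union_of_subset hDD'] at this
  intro S
  induction S using Finset.induction_on with
  | empty => intro; rw [empty_union]
  | insert a S ha ih =>
    intro hS
    have haD : a ∉ S ∪ D := by
      rw [mem_union, not_or]
      exact ⟨ha, hS a (mem_insert_self a S)⟩
    rw [insert_union, cubeLift_insert haD fun A => ?_]
    · exact ih fun e he => hS e (mem_insert_of_mem he)
    · rw [hB (A ∩ (S ∪ D)), inter_assoc, inter_eq_right.2 subset_union_right, ← hB]

/-- The indicator of "`x_e = 1`" lifts (in the window `{e}`) to `x_e = (1 - y_e)/2`. [cite: Grigoriev2001TCS, Lemma 10 (proof)] -/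
theorem cubeLift_indicator_mem (e : ℕ) :
    cubeLift {e} (fun A => if e ∈ A then (1 : ℝ) else 0) = phiX e := by
  have hp : ({e} : Finset ℕ).powerset = {∅, {e}} := by
    ext A
    rw [mem_powerset, subset_singleton_iff, mem_insert, mem_singleton]
  rw [cubeLift_apply, hp, sum_pair (ne_of_beq_false rfl).symm]
  · simp only [notMem_empty, if_false, zero_smul, zero_add, mem_singleton, if_true, one_smul]
    unfold patternIdem
    rw [prod_singleton, if_pos (mem_singleton_self e)]

/-! ### Support control -/

/-- Every monomial `y_T` of a lift over the window `D` has `T ⊆ D`. [cite: Grigoriev2001TCS, Lemma 10 (proof)] -/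
theorem suppIn_cubeLift (D : Finset ℕ) (B : Finset ℕ → ℝ) : SuppIn D (cubeLift D B) := by
  rw [cubeLift_apply]
  exact SuppIn.sum fun A _ => (suppIn_patternIdem D A).smul _

/-- … hence `|T| ≤ |D|`. [cite: Grigoriev2001TCS, Lemma 10 (proof)] -/
theorem SuppIn.card_support_le {B : Finset ℕ} {x : ParityAlg} (h : SuppIn B x) {T : ParityVec}
    (hT : T ∈ x.coeff.support) : T.support.card ≤ B.card :=
  card_le_card (h T hT)

/-! ### The parity junta lifts to `(1 + y_D)/2` -/

/-- `y_D = ∏_{e ∈ D} y_e` for the indicator parity vector of `D`. [cite: Grigoriev2001TCS, Lemma 10 (proof)] -/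
theorem yMon_indVec_eq_prod (D : Finset ℕ) :
    yMon (indVec D) = ∏ e ∈ D, yMon (Finsupp.single e 1) := by
  classical
  rw [indVec_eq_sum]
  induction D using Finset.induction_on with
  | empty => rw [sum_empty, prod_empty, yMon_zero]
  | insert a s ha ih => rw [sum_insert ha, prod_insert ha, ← yMon_mul, ih]

/-- `y_D · ι_{D,A} = (-1)^{|D ∩ A|} ι_{D,A}`: on the pattern `A`, `y_e = -1` exactly for `e ∈ A`.
[cite: Grigoriev2001TCS, Lemma 10 (proof)] -/
theorem yMon_indVec_mul_patternIdem (D A : Finset ℕ) :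
    yMon (indVec D) * patternIdem D A = (-1) ^ (D ∩ A).card * patternIdem D A := by
  rw [yMon_indVec_eq_prod, patternIdem, ← prod_mul_distrib]
  have h : ∀ e ∈ D, yMon (Finsupp.single e 1) * (if e ∈ A then phiX e else 1 - phiX e) =
      (if e ∈ A then (-1 : ParityAlg) else 1) * (if e ∈ A then phiX e else 1 - phiX e) := by
    intro e _
    split_ifs
    · rw [yMon_single_mul_phiX, neg_one_mul]
    · rw [yMon_single_mul_one_sub_phiX, one_mul]
  rw [prod_congr rfl h, prod_mul_distrib, prod_ite, prod_const, prod_const_one, mul_one,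
    filter_mem_eq_inter]

/-- **The parity junta lifts to `(1 + y_D)/2`.** `Σ_{A ⊆ D, |A| even} ι_{D,A} = (1 + ∏_{e∈D} y_e)/2`
— the element annihilated by a moment functional whose parity constraint on `D` has right-hand
side `-1`. [cite: Grigoriev2001TCS, Lemma 10 (the Tseitin equations inside the reduction)] -/
theorem cubeLift_even (D : Finset ℕ) :
    cubeLift D (fun A => if Even A.card then (1 : ℝ) else 0) =
      (1 / 2 : ℝ) • (1 + yMon (indVec D)) := by
  rw [cubeLift_apply]
  have h1 : (1 : ParityAlg) + yMon (indVec D) =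
      ∑ A ∈ D.powerset, (1 + (-1 : ParityAlg) ^ A.card) * patternIdem D A := by
    calc (1 : ParityAlg) + yMon (indVec D)
        = (1 + yMon (indVec D)) * ∑ A ∈ D.powerset, patternIdem D A := by
          rw [sum_patternIdem, mul_one]
      _ = ∑ A ∈ D.powerset, (1 + (-1 : ParityAlg) ^ A.card) * patternIdem D A := by
          rw [mul_sum]
          refine sum_congr rfl fun A hA => ?_
          rw [add_mul, one_mul, yMon_indVec_mul_patternIdem,
            inter_eq_right.2 (mem_powerset.1 hA), add_mul, one_mul]
  rw [h1, smul_sum]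
  refine sum_congr rfl fun A _ => ?_
  rcases Nat.even_or_odd A.card with hev | hodd
  · rw [if_pos hev, hev.neg_one_pow, one_add_one_eq_two, one_smul,
      show (2 : ParityAlg) = algebraMap ℝ ParityAlg 2 from (map_ofNat _ 2).symm,
      ← Algebra.smul_def, smul_smul]
    norm_num
  · rw [if_neg (Nat.not_even_iff_odd.2 hodd), hodd.neg_one_pow, add_neg_cancel, zero_mul,
      smul_zero, zero_smul]

/-- Junta form of `cubeLift_even`: the function `A ↦ [ |A ∩ D| even ]` (a genuine `D`-junta) has
the same lift. [cite: Grigoriev2001TCS, Lemma 10 (proof)] -/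
theorem cubeLift_even_inter (D : Finset ℕ) :
    cubeLift D (fun A => if Even (A ∩ D).card then (1 : ℝ) else 0) =
      (1 / 2 : ℝ) • (1 + yMon (indVec D)) := by
  rw [← cubeLift_even D]
  exact cubeLift_congr fun A hA => by rw [inter_eq_left.2 hA]

/-! ### What a moment functional does to `(1 + y_D)/2 · z` -/

section Annihilation

variable {ι : Type*} [DecidableEq ι] {g : ι → ParityVec} {b : ι → ℝ} {r c : ℝ} {d : ℕ}

/-- The moment functional in coordinates: `L(z) = Σ_U z_U Ẽ[y_U]`. [cite: Grigoriev2001TCS, Lemma 10 (proof)] -/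
theorem momentFunctional_apply (e : ParityVec → ℝ) (z : ParityAlg) :
    momentFunctional e z = ∑ U ∈ z.coeff.support, z.coeff U * e U := by
  have h := momentFunctional_mul e 1 z
  rw [one_mul] at h
  rw [h, AddMonoidAlgebra.one_def, AddMonoidAlgebra.coeff_single, Finsupp.support_single _
    one_ne_zero, sum_singleton]
  refine sum_congr rfl fun U _ => ?_
  rw [Finsupp.single_eq_same, one_mul, zero_add]

/-- **Annihilation of the parity factor.** For a Grigoriev–Schoenebeck moment sequence with
`b i = -1` and `g i = indVec D`: `L((1 + y_D) · z) = 0` for every `z` whose monomials `y_T` have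
`|T| + |D| ≤ d` (`Ẽ[y_{D+T}] = b_i Ẽ[y_T] = -Ẽ[y_T]`, and non-derivable `T` stay non-derivable).
[cite: Grigoriev2001TCS, Lemma 10 with §2 (the Theorem)] -/
theorem momentFunctional_one_add_yMon_mul (hexp : VecExpands g r c) (hc : 0 < c)
    (hd : (d : ℝ) ≤ c * r / 2) (hr : 2 ≤ r) (hb : ∀ i, b i * b i = 1) (i : ι) {D : Finset ℕ}
    (hgi : g i = indVec D) (hbi : b i = -1) (z : ParityAlg)
    (hz : ∀ T ∈ z.coeff.support, T.support.card + D.card ≤ d) :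
    momentFunctional (pseudoMoment g b r d) ((1 + yMon (indVec D)) * z) = 0 := by
  classical
  rw [add_mul, one_mul, map_add, yMon, momentFunctional_single_mul, momentFunctional_apply,
    ← sum_add_distrib]
  refine sum_eq_zero fun U hU => ?_
  have hUd : U.support.card ≤ d := le_trans (Nat.le_add_right _ _) (hz U hU)
  have hDU : (g i + U).support.card ≤ d := by
    refine (card_support_add_le _ _).trans ?_
    rw [hgi, support_indVec, add_comm]
    exact hz U hU
  rw [← hgi, one_mul]
  by_cases hder : Derivable g r d U
  · rw [(pseudoMoment_index_add hexp hc hd hr hb i hder hDU).2, hbi]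
    ring
  · rw [pseudoMoment_of_not hder,
      pseudoMoment_of_not (not_derivable_index_add hexp hc hd hr hb i hder hUd)]
    ring

end Annihilation

end Literature.Computability.MetaComplexity
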